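import Summits.BirchSwinnertonDyer.Rank1Residual.Additive.X3ThreeLineDatum
import Summits.BirchSwinnertonDyer.Rank1Residual.X2.CellAGVParCertificatesN9A
import Mathlib.Tactic.Simproc.Factors
import HarnessLib

/-!
# X3♯(G-ord, `e = 2`) at `p = 3`: kernel records of the per-pair LINE DATUM `X3LineDatumThree W` for the
# Case-1 members of the B-X3G booking list — part E of 16 (cell `bsd-addord`, seat
# `bsd-addord-twist`, strategy = twist transport)

HONEST FRAMING (cell `bsd-addord`, `run/shared/lean/pub/bsd-addord/README.md` §4): the programme's
target of record is the full Birch–Swinnerton-Dyer formula for every `E/ℚ` of analytic rank `≤ 1`.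
DATA-RECORDS module: theorems only (no definition, no named fact, no `sorry`); it BOOKS NOTHING and
moves no mark — booking is the planner's act (TARGET.md v5.5 §8 protocol B-X3G, (iv)).

## What is recorded

For each isogeny class `(N, class, 3)` of the booking list `HOME/bsd-addord-twist-booking-members.tsv`
(kit job j242057; the r_an = 0, non-CM, non-degenerate branch-parity classes of cell (G-ord, `e = 2`) at
`p = 3` in census v2, planner keys `HOME/planner/bx3g/`), the CASE-1 MEMBER `W = [a₁, a₂, a₃, a₄, a₆]`
(Cremona's globally minimal model; the first member in Cremona order carrying the EVEN rational `3`-line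
as a SUB-line) and the theorem `X3LineDatumThree W` — SOME rational `3`-line `Φ₀ ≤ W[3]` which is even,
has non-trivial `Γ_ℚ`-action and `χ_{−3}`-twist ramified at `3` — proved by
`x3LineDatumThree_of_cert_of_delta` from the certificate `(x₀, s, D, q)`: `Ψ₃(x₀) = 0`, `D` squarefree,
`s ≠ 0`, `D·s² = Ψ₂Sq(x₀)`, `0 < D`, `D ≠ 1`, `3 ∤ D` (`norm_num` identities, one prime-factor-list
computation with X2a's helper `squarefree_of_nodup_primeFactorsList_natAbs`, `decide`s). This is the per-pair line-datum input of
`ClassX3Gord.{{missingLowerBoundAt,bsdp}}_three_rankZero_of_facts_of_nonAnomalous`; the class binders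
(`ClassX3Gord W 3`, `¬ HasCM`, `analyticRank = 0`, `ReductionNonAnomalous W 3`) are data of record
(Cremona / the planner's two-engine census), NOT kernel statements here; the other members of each class
are reached by Cassels (`N10.bsdp_of_isIsogenous_of_bsdp`, binder `bsdRHS_eq_of_isIsogenous`). The
docstring of each record names the class, the anomalous bit of the twist `V = W ⊗ χ_{−3}` and `D`
(`φ = χ_D`). Records sorted by conductor.

References: [GreenbergVatsal2000] §2 p. 28 (the line `Φ`); lane file
`HOME/bsd-addord-twist-booking-members.tsv`; `Additive/X3ThreeLineDatum.lean`.
-/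

set_option autoImplicit false

open WeierstrassCurve Polynomial Literature.NumberTheory.EllipticCurves
  Literature.NumberTheory.EllipticCurves.Rank1Residual

namespace Summit.BirchSwinnertonDyer.Rank1Residual.Additive.X3ThreeLineDatumRecords

/-- `96237e2` = `[0,0,1,-60690,5572570]` (class `96237e`, (G-ord, `e = 2`) at `3`; twist `10693a2`, `a₃(V) = -1`, non-anomalous; even line
`φ = χ_{17}`): `x₀ = 204`, `D = 17`, `s = 629`, `Ψ₂Sq(x₀) = 6725897` ⇒ `X3LineDatumThree W`. [folklore] -/
theorem x3LineDatumThree_96237e2 : X3LineDatumThree (⟨0, 0, 1, -60690, 5572570⟩ : WeierstrassCurve ℚ) :=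
  x3LineDatumThree_of_cert_of_delta _ (by norm_num [Δ, b₂, b₄, b₆, b₈]) 204 629 17
    (by simp only [Ψ₃, eval_add, eval_mul, eval_pow, eval_C, eval_X, eval_ofNat]; norm_num [b₂, b₄, b₆, b₈])
    (X2.CellACertN9.squarefree_of_nodup_primeFactorsList_natAbs (by norm_num) (by simp [Nat.primeFactorsList_ofNat])) (by norm_num)
    (by rw [KernelDisc.eval_Ψ₂Sq]; norm_num [b₂, b₄, b₆]) (by decide) (by decide) (by decide)

/-- `97344cl2` = `[0,0,0,-440076,223953392]` (class `97344cl`, (G-ord, `e = 2`) at `3`; twist `10816i2`, `a₃(V) = -1`, non-anomalous; even line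
`φ = χ_{26}`): `x₀ = 78`, `D = 26`, `s = 5408`, `Ψ₂Sq(x₀) = 760408064` ⇒ `X3LineDatumThree W`. [folklore] -/
theorem x3LineDatumThree_97344cl2 : X3LineDatumThree (⟨0, 0, 0, -440076, 223953392⟩ : WeierstrassCurve ℚ) :=
  x3LineDatumThree_of_cert_of_delta _ (by norm_num [Δ, b₂, b₄, b₆, b₈]) 78 5408 26
    (by simp only [Ψ₃, eval_add, eval_mul, eval_pow, eval_C, eval_X, eval_ofNat]; norm_num [b₂, b₄, b₆, b₈])
    (X2.CellACertN9.squarefree_of_nodup_primeFactorsList_natAbs (by norm_num) (by simp [Nat.primeFactorsList_ofNat])) (by norm_num)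
    (by rw [KernelDisc.eval_Ψ₂Sq]; norm_num [b₂, b₄, b₆]) (by decide) (by decide) (by decide)

/-- `97344cn2` = `[0,0,0,-18876,998192]` (class `97344cn`, (G-ord, `e = 2`) at `3`; twist `10816m2`, `a₃(V) = 2`, non-anomalous; even line
`φ = χ_{26}`): `x₀ = 78`, `D = 26`, `s = 8`, `Ψ₂Sq(x₀) = 1664` ⇒ `X3LineDatumThree W`. [folklore] -/
theorem x3LineDatumThree_97344cn2 : X3LineDatumThree (⟨0, 0, 0, -18876, 998192⟩ : WeierstrassCurve ℚ) :=
  x3LineDatumThree_of_cert_of_delta _ (by norm_num [Δ, b₂, b₄, b₆, b₈]) 78 8 26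
    (by simp only [Ψ₃, eval_add, eval_mul, eval_pow, eval_C, eval_X, eval_ofNat]; norm_num [b₂, b₄, b₆, b₈])
    (X2.CellACertN9.squarefree_of_nodup_primeFactorsList_natAbs (by norm_num) (by simp [Nat.primeFactorsList_ofNat])) (by norm_num)
    (by rw [KernelDisc.eval_Ψ₂Sq]; norm_num [b₂, b₄, b₆]) (by decide) (by decide) (by decide)

/-- `97344cs2` = `[0,0,0,-3190044,2193027824]` (class `97344cs`, (G-ord, `e = 2`) at `3`; twist `10816l2`, `a₃(V) = 2`, non-anomalous; even line
`φ = χ_{2}`): `x₀ = 1014`, `D = 2`, `s = 1352`, `Ψ₂Sq(x₀) = 3655808` ⇒ `X3LineDatumThree W`. [folklore] -/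
theorem x3LineDatumThree_97344cs2 : X3LineDatumThree (⟨0, 0, 0, -3190044, 2193027824⟩ : WeierstrassCurve ℚ) :=
  x3LineDatumThree_of_cert_of_delta _ (by norm_num [Δ, b₂, b₄, b₆, b₈]) 1014 1352 2
    (by simp only [Ψ₃, eval_add, eval_mul, eval_pow, eval_C, eval_X, eval_ofNat]; norm_num [b₂, b₄, b₆, b₈])
    Int.prime_two.squarefree (by norm_num)
    (by rw [KernelDisc.eval_Ψ₂Sq]; norm_num [b₂, b₄, b₆]) (by decide) (by decide) (by decide)

/-- `97650dg2` = `[1,-1,1,8095,1439097]` (class `97650dg`, (G-ord, `e = 2`) at `3`; twist `10850h2`, `a₃(V) = -1`, non-anomalous; even line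
`φ = χ_{5}`): `x₀ = 4`, `D = 5`, `s = 1085`, `Ψ₂Sq(x₀) = 5886125` ⇒ `X3LineDatumThree W`. [folklore] -/
theorem x3LineDatumThree_97650dg2 : X3LineDatumThree (⟨1, -1, 1, 8095, 1439097⟩ : WeierstrassCurve ℚ) :=
  x3LineDatumThree_of_cert_of_delta _ (by norm_num [Δ, b₂, b₄, b₆, b₈]) 4 1085 5
    (by simp only [Ψ₃, eval_add, eval_mul, eval_pow, eval_C, eval_X, eval_ofNat]; norm_num [b₂, b₄, b₆, b₈])
    (X2.CellACertN9.squarefree_of_nodup_primeFactorsList_natAbs (by norm_num) (by simp [Nat.primeFactorsList_ofNat])) (by norm_num)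
    (by rw [KernelDisc.eval_Ψ₂Sq]; norm_num [b₂, b₄, b₆]) (by decide) (by decide) (by decide)

/-- `98838bl2` = `[1,-1,1,24655,-11873055]` (class `98838bl`, (G-ord, `e = 2`) at `3`; twist `10982b2`, `a₃(V) = -1`, non-anomalous; even line
`φ = χ_{17}`): `x₀ = 319`, `D = 17`, `s = 2584`, `Ψ₂Sq(x₀) = 113509952` ⇒ `X3LineDatumThree W`. [folklore] -/
theorem x3LineDatumThree_98838bl2 : X3LineDatumThree (⟨1, -1, 1, 24655, -11873055⟩ : WeierstrassCurve ℚ) :=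
  x3LineDatumThree_of_cert_of_delta _ (by norm_num [Δ, b₂, b₄, b₆, b₈]) 319 2584 17
    (by simp only [Ψ₃, eval_add, eval_mul, eval_pow, eval_C, eval_X, eval_ofNat]; norm_num [b₂, b₄, b₆, b₈])
    (X2.CellACertN9.squarefree_of_nodup_primeFactorsList_natAbs (by norm_num) (by simp [Nat.primeFactorsList_ofNat])) (by norm_num)
    (by rw [KernelDisc.eval_Ψ₂Sq]; norm_num [b₂, b₄, b₆]) (by decide) (by decide) (by decide)

/-- `99450s3` = `[1,-1,0,-1893942,78065716]` (class `99450s`, (G-ord, `e = 2`) at `3`; twist `11050l3`, `a₃(V) = 2`, non-anomalous; even line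
`φ = χ_{5}`): `x₀ = 1984`, `D = 5`, `s = 57460`, `Ψ₂Sq(x₀) = 16508258000` ⇒ `X3LineDatumThree W`. [folklore] -/
theorem x3LineDatumThree_99450s3 : X3LineDatumThree (⟨1, -1, 0, -1893942, 78065716⟩ : WeierstrassCurve ℚ) :=
  x3LineDatumThree_of_cert_of_delta _ (by norm_num [Δ, b₂, b₄, b₆, b₈]) 1984 57460 5
    (by simp only [Ψ₃, eval_add, eval_mul, eval_pow, eval_C, eval_X, eval_ofNat]; norm_num [b₂, b₄, b₆, b₈])
    (X2.CellACertN9.squarefree_of_nodup_primeFactorsList_natAbs (by norm_num) (by simp [Nat.primeFactorsList_ofNat])) (by norm_num)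
    (by rw [KernelDisc.eval_Ψ₂Sq]; norm_num [b₂, b₄, b₆]) (by decide) (by decide) (by decide)

/-- `100800da3` = `[0,0,0,64500,10582000]` (class `100800da`, (G-ord, `e = 2`) at `3`; twist `11200j3`, `a₃(V) = -2` — ANOMALOUS (outside the end state as typed); even line
`φ = χ_{10}`): `x₀ = 30`, `D = 10`, `s = 2240`, `Ψ₂Sq(x₀) = 50176000` ⇒ `X3LineDatumThree W`. [folklore] -/
theorem x3LineDatumThree_100800da3 : X3LineDatumThree (⟨0, 0, 0, 64500, 10582000⟩ : WeierstrassCurve ℚ) :=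
  x3LineDatumThree_of_cert_of_delta _ (by norm_num [Δ, b₂, b₄, b₆, b₈]) 30 2240 10
    (by simp only [Ψ₃, eval_add, eval_mul, eval_pow, eval_C, eval_X, eval_ofNat]; norm_num [b₂, b₄, b₆, b₈])
    (X2.CellACertN9.squarefree_of_nodup_primeFactorsList_natAbs (by norm_num) (by simp [Nat.primeFactorsList_ofNat])) (by norm_num)
    (by rw [KernelDisc.eval_Ψ₂Sq]; norm_num [b₂, b₄, b₆]) (by decide) (by decide) (by decide)

/-- `100800do2` = `[0,0,0,-724800,237508000]` (class `100800do`, (G-ord, `e = 2`) at `3`; twist `11200d2`, `a₃(V) = 1` — ANOMALOUS (outside the end state as typed); even line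
`φ = χ_{10}`): `x₀ = 480`, `D = 10`, `s = 280`, `Ψ₂Sq(x₀) = 784000` ⇒ `X3LineDatumThree W`. [folklore] -/
theorem x3LineDatumThree_100800do2 : X3LineDatumThree (⟨0, 0, 0, -724800, 237508000⟩ : WeierstrassCurve ℚ) :=
  x3LineDatumThree_of_cert_of_delta _ (by norm_num [Δ, b₂, b₄, b₆, b₈]) 480 280 10
    (by simp only [Ψ₃, eval_add, eval_mul, eval_pow, eval_C, eval_X, eval_ofNat]; norm_num [b₂, b₄, b₆, b₈])
    (X2.CellACertN9.squarefree_of_nodup_primeFactorsList_natAbs (by norm_num) (by simp [Nat.primeFactorsList_ofNat])) (by norm_num)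
    (by rw [KernelDisc.eval_Ψ₂Sq]; norm_num [b₂, b₄, b₆]) (by decide) (by decide) (by decide)

/-- `100800dp2` = `[0,0,0,-26220,2296240]` (class `100800dp`, (G-ord, `e = 2`) at `3`; twist `11200e2`, `a₃(V) = 1` — ANOMALOUS (outside the end state as typed); even line
`φ = χ_{10}`): `x₀ = 30`, `D = 10`, `s = 784`, `Ψ₂Sq(x₀) = 6146560` ⇒ `X3LineDatumThree W`. [folklore] -/
theorem x3LineDatumThree_100800dp2 : X3LineDatumThree (⟨0, 0, 0, -26220, 2296240⟩ : WeierstrassCurve ℚ) :=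
  x3LineDatumThree_of_cert_of_delta _ (by norm_num [Δ, b₂, b₄, b₆, b₈]) 30 784 10
    (by simp only [Ψ₃, eval_add, eval_mul, eval_pow, eval_C, eval_X, eval_ofNat]; norm_num [b₂, b₄, b₆, b₈])
    (X2.CellACertN9.squarefree_of_nodup_primeFactorsList_natAbs (by norm_num) (by simp [Nat.primeFactorsList_ofNat])) (by norm_num)
    (by rw [KernelDisc.eval_Ψ₂Sq]; norm_num [b₂, b₄, b₆]) (by decide) (by decide) (by decide)

/-- `100800dq2` = `[0,0,0,-3540,81160]` (class `100800dq`, (G-ord, `e = 2`) at `3`; twist `11200k2`, `a₃(V) = -2` — ANOMALOUS (outside the end state as typed); even line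
`φ = χ_{10}`): `x₀ = 30`, `D = 10`, `s = 28`, `Ψ₂Sq(x₀) = 7840` ⇒ `X3LineDatumThree W`. [folklore] -/
theorem x3LineDatumThree_100800dq2 : X3LineDatumThree (⟨0, 0, 0, -3540, 81160⟩ : WeierstrassCurve ℚ) :=
  x3LineDatumThree_of_cert_of_delta _ (by norm_num [Δ, b₂, b₄, b₆, b₈]) 30 28 10
    (by simp only [Ψ₃, eval_add, eval_mul, eval_pow, eval_C, eval_X, eval_ofNat]; norm_num [b₂, b₄, b₆, b₈])
    (X2.CellACertN9.squarefree_of_nodup_primeFactorsList_natAbs (by norm_num) (by simp [Nat.primeFactorsList_ofNat])) (by norm_num)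
    (by rw [KernelDisc.eval_Ψ₂Sq]; norm_num [b₂, b₄, b₆]) (by decide) (by decide) (by decide)

/-- `100800dw2` = `[0,0,0,7800,45250]` (class `100800dw`, (G-ord, `e = 2`) at `3`; twist `11200c2`, `a₃(V) = 1` — ANOMALOUS (outside the end state as typed); even line
`φ = χ_{10}`): `x₀ = 30`, `D = 10`, `s = 350`, `Ψ₂Sq(x₀) = 1225000` ⇒ `X3LineDatumThree W`. [folklore] -/
theorem x3LineDatumThree_100800dw2 : X3LineDatumThree (⟨0, 0, 0, 7800, 45250⟩ : WeierstrassCurve ℚ) :=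
  x3LineDatumThree_of_cert_of_delta _ (by norm_num [Δ, b₂, b₄, b₆, b₈]) 30 350 10
    (by simp only [Ψ₃, eval_add, eval_mul, eval_pow, eval_C, eval_X, eval_ofNat]; norm_num [b₂, b₄, b₆, b₈])
    (X2.CellACertN9.squarefree_of_nodup_primeFactorsList_natAbs (by norm_num) (by simp [Nat.primeFactorsList_ofNat])) (by norm_num)
    (by rw [KernelDisc.eval_Ψ₂Sq]; norm_num [b₂, b₄, b₆]) (by decide) (by decide) (by decide)

/-- `100800hz2` = `[0,0,0,-655500,287030000]` (class `100800hz`, (G-ord, `e = 2`) at `3`; twist `11200bq2`, `a₃(V) = -1`, non-anomalous; even line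
`φ = χ_{2}`): `x₀ = 150`, `D = 2`, `s = 19600`, `Ψ₂Sq(x₀) = 768320000` ⇒ `X3LineDatumThree W`. [folklore] -/
theorem x3LineDatumThree_100800hz2 : X3LineDatumThree (⟨0, 0, 0, -655500, 287030000⟩ : WeierstrassCurve ℚ) :=
  x3LineDatumThree_of_cert_of_delta _ (by norm_num [Δ, b₂, b₄, b₆, b₈]) 150 19600 2
    (by simp only [Ψ₃, eval_add, eval_mul, eval_pow, eval_C, eval_X, eval_ofNat]; norm_num [b₂, b₄, b₆, b₈])
    Int.prime_two.squarefree (by norm_num)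
    (by rw [KernelDisc.eval_Ψ₂Sq]; norm_num [b₂, b₄, b₆]) (by decide) (by decide) (by decide)

/-- `100800ia2` = `[0,0,0,-88500,10145000]` (class `100800ia`, (G-ord, `e = 2`) at `3`; twist `11200br2`, `a₃(V) = 2`, non-anomalous; even line
`φ = χ_{2}`): `x₀ = 150`, `D = 2`, `s = 700`, `Ψ₂Sq(x₀) = 980000` ⇒ `X3LineDatumThree W`. [folklore] -/
theorem x3LineDatumThree_100800ia2 : X3LineDatumThree (⟨0, 0, 0, -88500, 10145000⟩ : WeierstrassCurve ℚ) :=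
  x3LineDatumThree_of_cert_of_delta _ (by norm_num [Δ, b₂, b₄, b₆, b₈]) 150 700 2
    (by simp only [Ψ₃, eval_add, eval_mul, eval_pow, eval_C, eval_X, eval_ofNat]; norm_num [b₂, b₄, b₆, b₈])
    Int.prime_two.squarefree (by norm_num)
    (by rw [KernelDisc.eval_Ψ₂Sq]; norm_num [b₂, b₄, b₆]) (by decide) (by decide) (by decide)

/-- `103104g2` = `[0,0,0,18420,-2036752]` (class `103104g`, (G-ord, `e = 2`) at `3`; twist `11456c2`, `a₃(V) = 2`, non-anomalous; even line
`φ = χ_{2}`): `x₀ = 150`, `D = 2`, `s = 2864`, `Ψ₂Sq(x₀) = 16404992` ⇒ `X3LineDatumThree W`. [folklore] -/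
theorem x3LineDatumThree_103104g2 : X3LineDatumThree (⟨0, 0, 0, 18420, -2036752⟩ : WeierstrassCurve ℚ) :=
  x3LineDatumThree_of_cert_of_delta _ (by norm_num [Δ, b₂, b₄, b₆, b₈]) 150 2864 2
    (by simp only [Ψ₃, eval_add, eval_mul, eval_pow, eval_C, eval_X, eval_ofNat]; norm_num [b₂, b₄, b₆, b₈])
    Int.prime_two.squarefree (by norm_num)
    (by rw [KernelDisc.eval_Ψ₂Sq]; norm_num [b₂, b₄, b₆]) (by decide) (by decide) (by decide)

/-- `106425h2` = `[0,0,1,-108300,13612531]` (class `106425h`, (G-ord, `e = 2`) at `3`; twist `11825e2`, `a₃(V) = -1`, non-anomalous; even line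
`φ = χ_{5}`): `x₀ = 240`, `D = 5`, `s = 1075`, `Ψ₂Sq(x₀) = 5778125` ⇒ `X3LineDatumThree W`. [folklore] -/
theorem x3LineDatumThree_106425h2 : X3LineDatumThree (⟨0, 0, 1, -108300, 13612531⟩ : WeierstrassCurve ℚ) :=
  x3LineDatumThree_of_cert_of_delta _ (by norm_num [Δ, b₂, b₄, b₆, b₈]) 240 1075 5
    (by simp only [Ψ₃, eval_add, eval_mul, eval_pow, eval_C, eval_X, eval_ofNat]; norm_num [b₂, b₄, b₆, b₈])
    (X2.CellACertN9.squarefree_of_nodup_primeFactorsList_natAbs (by norm_num) (by simp [Nat.primeFactorsList_ofNat])) (by norm_num)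
    (by rw [KernelDisc.eval_Ψ₂Sq]; norm_num [b₂, b₄, b₆]) (by decide) (by decide) (by decide)

/-- `106470bd2` = `[1,-1,0,-89010,68172300]` (class `106470bd`, (G-ord, `e = 2`) at `3`; twist `11830w2`, `a₃(V) = 1` — ANOMALOUS (outside the end state as typed); even line
`φ = χ_{13}`): `x₀ = 10`, `D = 13`, `s = 4550`, `Ψ₂Sq(x₀) = 269132500` ⇒ `X3LineDatumThree W`. [folklore] -/
theorem x3LineDatumThree_106470bd2 : X3LineDatumThree (⟨1, -1, 0, -89010, 68172300⟩ : WeierstrassCurve ℚ) :=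
  x3LineDatumThree_of_cert_of_delta _ (by norm_num [Δ, b₂, b₄, b₆, b₈]) 10 4550 13
    (by simp only [Ψ₃, eval_add, eval_mul, eval_pow, eval_C, eval_X, eval_ofNat]; norm_num [b₂, b₄, b₆, b₈])
    (X2.CellACertN9.squarefree_of_nodup_primeFactorsList_natAbs (by norm_num) (by simp [Nat.primeFactorsList_ofNat])) (by norm_num)
    (by rw [KernelDisc.eval_Ψ₂Sq]; norm_num [b₂, b₄, b₆]) (by decide) (by decide) (by decide)

/-- `106470s3` = `[1,-1,0,-1442700,587898000]` (class `106470s`, (G-ord, `e = 2`) at `3`; twist `11830x3`, `a₃(V) = -2` — ANOMALOUS (outside the end state as typed); even line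
`φ = χ_{13}`): `x₀ = 1180`, `D = 13`, `s = 12740`, `Ψ₂Sq(x₀) = 2109998800` ⇒ `X3LineDatumThree W`. [folklore] -/
theorem x3LineDatumThree_106470s3 : X3LineDatumThree (⟨1, -1, 0, -1442700, 587898000⟩ : WeierstrassCurve ℚ) :=
  x3LineDatumThree_of_cert_of_delta _ (by norm_num [Δ, b₂, b₄, b₆, b₈]) 1180 12740 13
    (by simp only [Ψ₃, eval_add, eval_mul, eval_pow, eval_C, eval_X, eval_ofNat]; norm_num [b₂, b₄, b₆, b₈])
    (X2.CellACertN9.squarefree_of_nodup_primeFactorsList_natAbs (by norm_num) (by simp [Nat.primeFactorsList_ofNat])) (by norm_num)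
    (by rw [KernelDisc.eval_Ψ₂Sq]; norm_num [b₂, b₄, b₆]) (by decide) (by decide) (by decide)

/-- `106470u2` = `[1,-1,0,-89519715,-326298516075]` (class `106470u`, (G-ord, `e = 2`) at `3`; twist `11830u2`, `a₃(V) = 1` — ANOMALOUS (outside the end state as typed); even line
`φ = χ_{13}`): `x₀ = 16390`, `D = 13`, `s = 896000`, `Ψ₂Sq(x₀) = 10436608000000` ⇒ `X3LineDatumThree W`. [folklore] -/
theorem x3LineDatumThree_106470u2 : X3LineDatumThree (⟨1, -1, 0, -89519715, -326298516075⟩ : WeierstrassCurve ℚ) :=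
  x3LineDatumThree_of_cert_of_delta _ (by norm_num [Δ, b₂, b₄, b₆, b₈]) 16390 896000 13
    (by simp only [Ψ₃, eval_add, eval_mul, eval_pow, eval_C, eval_X, eval_ofNat]; norm_num [b₂, b₄, b₆, b₈])
    (X2.CellACertN9.squarefree_of_nodup_primeFactorsList_natAbs (by norm_num) (by simp [Nat.primeFactorsList_ofNat])) (by norm_num)
    (by rw [KernelDisc.eval_Ψ₂Sq]; norm_num [b₂, b₄, b₆]) (by decide) (by decide) (by decide)

/-- `106470v2` = `[1,-1,0,-9002070,10398767796]` (class `106470v`, (G-ord, `e = 2`) at `3`; twist `11830v2`, `a₃(V) = 1` — ANOMALOUS (outside the end state as typed); even line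
`φ = χ_{13}`): `x₀ = 1648`, `D = 13`, `s = 3380`, `Ψ₂Sq(x₀) = 148517200` ⇒ `X3LineDatumThree W`. [folklore] -/
theorem x3LineDatumThree_106470v2 : X3LineDatumThree (⟨1, -1, 0, -9002070, 10398767796⟩ : WeierstrassCurve ℚ) :=
  x3LineDatumThree_of_cert_of_delta _ (by norm_num [Δ, b₂, b₄, b₆, b₈]) 1648 3380 13
    (by simp only [Ψ₃, eval_add, eval_mul, eval_pow, eval_C, eval_X, eval_ofNat]; norm_num [b₂, b₄, b₆, b₈])
    (X2.CellACertN9.squarefree_of_nodup_primeFactorsList_natAbs (by norm_num) (by simp [Nat.primeFactorsList_ofNat])) (by norm_num)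
    (by rw [KernelDisc.eval_Ψ₂Sq]; norm_num [b₂, b₄, b₆]) (by decide) (by decide) (by decide)

/-- `106560bf2` = `[0,0,0,-10668,-4752592]` (class `106560bf`, (G-ord, `e = 2`) at `3`; twist `11840k2`, `a₃(V) = 2`, non-anomalous; even line
`φ = χ_{2}`): `x₀ = 294`, `D = 2`, `s = 5920`, `Ψ₂Sq(x₀) = 70092800` ⇒ `X3LineDatumThree W`. [folklore] -/
theorem x3LineDatumThree_106560bf2 : X3LineDatumThree (⟨0, 0, 0, -10668, -4752592⟩ : WeierstrassCurve ℚ) :=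
  x3LineDatumThree_of_cert_of_delta _ (by norm_num [Δ, b₂, b₄, b₆, b₈]) 294 5920 2
    (by simp only [Ψ₃, eval_add, eval_mul, eval_pow, eval_C, eval_X, eval_ofNat]; norm_num [b₂, b₄, b₆, b₈])
    Int.prime_two.squarefree (by norm_num)
    (by rw [KernelDisc.eval_Ψ₂Sq]; norm_num [b₂, b₄, b₆]) (by decide) (by decide) (by decide)

/-- `106560bh2` = `[0,0,0,-432768,109579808]` (class `106560bh`, (G-ord, `e = 2`) at `3`; twist `11840j2`, `a₃(V) = -1`, non-anomalous; even line
`φ = χ_{2}`): `x₀ = 384`, `D = 2`, `s = 200`, `Ψ₂Sq(x₀) = 80000` ⇒ `X3LineDatumThree W`. [folklore] -/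
theorem x3LineDatumThree_106560bh2 : X3LineDatumThree (⟨0, 0, 0, -432768, 109579808⟩ : WeierstrassCurve ℚ) :=
  x3LineDatumThree_of_cert_of_delta _ (by norm_num [Δ, b₂, b₄, b₆, b₈]) 384 200 2
    (by simp only [Ψ₃, eval_add, eval_mul, eval_pow, eval_C, eval_X, eval_ofNat]; norm_num [b₂, b₄, b₆, b₈])
    Int.prime_two.squarefree (by norm_num)
    (by rw [KernelDisc.eval_Ψ₂Sq]; norm_num [b₂, b₄, b₆]) (by decide) (by decide) (by decide)

/-- `106722cn2` = `[1,-1,0,-14435262,20899395292]` (class `106722cn`, (G-ord, `e = 2`) at `3`; twist `11858bh2`, `a₃(V) = -1`, non-anomalous; even line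
`φ = χ_{77}`): `x₀ = 2830`, `D = 77`, `s = 11858`, `Ψ₂Sq(x₀) = 10827136628` ⇒ `X3LineDatumThree W`. [folklore] -/
theorem x3LineDatumThree_106722cn2 : X3LineDatumThree (⟨1, -1, 0, -14435262, 20899395292⟩ : WeierstrassCurve ℚ) :=
  x3LineDatumThree_of_cert_of_delta _ (by norm_num [Δ, b₂, b₄, b₆, b₈]) 2830 11858 77
    (by simp only [Ψ₃, eval_add, eval_mul, eval_pow, eval_C, eval_X, eval_ofNat]; norm_num [b₂, b₄, b₆, b₈])
    (X2.CellACertN9.squarefree_of_nodup_primeFactorsList_natAbs (by norm_num) (by simp [Nat.primeFactorsList_ofNat])) (by norm_num)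
    (by rw [KernelDisc.eval_Ψ₂Sq]; norm_num [b₂, b₄, b₆]) (by decide) (by decide) (by decide)

/-- `106722co2` = `[1,-1,0,-3738807,37742557]` (class `106722co`, (G-ord, `e = 2`) at `3`; twist `11858bj2`, `a₃(V) = 2`, non-anomalous; even line
`φ = χ_{77}`): `x₀ = 2830`, `D = 77`, `s = 25088`, `Ψ₂Sq(x₀) = 48464396288` ⇒ `X3LineDatumThree W`. [folklore] -/
theorem x3LineDatumThree_106722co2 : X3LineDatumThree (⟨1, -1, 0, -3738807, 37742557⟩ : WeierstrassCurve ℚ) :=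
  x3LineDatumThree_of_cert_of_delta _ (by norm_num [Δ, b₂, b₄, b₆, b₈]) 2830 25088 77
    (by simp only [Ψ₃, eval_add, eval_mul, eval_pow, eval_C, eval_X, eval_ofNat]; norm_num [b₂, b₄, b₆, b₈])
    (X2.CellACertN9.squarefree_of_nodup_primeFactorsList_natAbs (by norm_num) (by simp [Nat.primeFactorsList_ofNat])) (by norm_num)
    (by rw [KernelDisc.eval_Ψ₂Sq]; norm_num [b₂, b₄, b₆]) (by decide) (by decide) (by decide)

/-- `107712cp2` = `[0,0,0,-3576,188282]` (class `107712cp`, (G-ord, `e = 2`) at `3`; twist `11968b2`, `a₃(V) = -1`, non-anomalous; even line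
`φ = χ_{2}`): `x₀ = 6`, `D = 2`, `s = 578`, `Ψ₂Sq(x₀) = 668168` ⇒ `X3LineDatumThree W`. [folklore] -/
theorem x3LineDatumThree_107712cp2 : X3LineDatumThree (⟨0, 0, 0, -3576, 188282⟩ : WeierstrassCurve ℚ) :=
  x3LineDatumThree_of_cert_of_delta _ (by norm_num [Δ, b₂, b₄, b₆, b₈]) 6 578 2
    (by simp only [Ψ₃, eval_add, eval_mul, eval_pow, eval_C, eval_X, eval_ofNat]; norm_num [b₂, b₄, b₆, b₈])
    Int.prime_two.squarefree (by norm_num)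
    (by rw [KernelDisc.eval_Ψ₂Sq]; norm_num [b₂, b₄, b₆]) (by decide) (by decide) (by decide)

/-- `108450br2` = `[1,-1,1,199570,25792197]` (class `108450br`, (G-ord, `e = 2`) at `3`; twist `12050b2`, `a₃(V) = -1`, non-anomalous; even line
`φ = χ_{5}`): `x₀ = 94`, `D = 5`, `s = 6025`, `Ψ₂Sq(x₀) = 181503125` ⇒ `X3LineDatumThree W`. [folklore] -/
theorem x3LineDatumThree_108450br2 : X3LineDatumThree (⟨1, -1, 1, 199570, 25792197⟩ : WeierstrassCurve ℚ) :=
  x3LineDatumThree_of_cert_of_delta _ (by norm_num [Δ, b₂, b₄, b₆, b₈]) 94 6025 5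
    (by simp only [Ψ₃, eval_add, eval_mul, eval_pow, eval_C, eval_X, eval_ofNat]; norm_num [b₂, b₄, b₆, b₈])
    (X2.CellACertN9.squarefree_of_nodup_primeFactorsList_natAbs (by norm_num) (by simp [Nat.primeFactorsList_ofNat])) (by norm_num)
    (by rw [KernelDisc.eval_Ψ₂Sq]; norm_num [b₂, b₄, b₆]) (by decide) (by decide) (by decide)

/-- `108900bs2` = `[0,0,0,-11879175,15764696750]` (class `108900bs`, (G-ord, `e = 2`) at `3`; twist `12100c2`, `a₃(V) = -1`, non-anomalous; even line
`φ = χ_{5}`): `x₀ = 1815`, `D = 5`, `s = 12100`, `Ψ₂Sq(x₀) = 732050000` ⇒ `X3LineDatumThree W`. [folklore] -/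
theorem x3LineDatumThree_108900bs2 : X3LineDatumThree (⟨0, 0, 0, -11879175, 15764696750⟩ : WeierstrassCurve ℚ) :=
  x3LineDatumThree_of_cert_of_delta _ (by norm_num [Δ, b₂, b₄, b₆, b₈]) 1815 12100 5
    (by simp only [Ψ₃, eval_add, eval_mul, eval_pow, eval_C, eval_X, eval_ofNat]; norm_num [b₂, b₄, b₆, b₈])
    (X2.CellACertN9.squarefree_of_nodup_primeFactorsList_natAbs (by norm_num) (by simp [Nat.primeFactorsList_ofNat])) (by norm_num)
    (by rw [KernelDisc.eval_Ψ₂Sq]; norm_num [b₂, b₄, b₆]) (by decide) (by decide) (by decide)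

/-- `113850bf2` = `[1,-1,0,-89217,10277941]` (class `113850bf`, (G-ord, `e = 2`) at `3`; twist `12650v2`, `a₃(V) = 2`, non-anomalous; even line
`φ = χ_{5}`): `x₀ = 184`, `D = 5`, `s = 230`, `Ψ₂Sq(x₀) = 264500` ⇒ `X3LineDatumThree W`. [folklore] -/
theorem x3LineDatumThree_113850bf2 : X3LineDatumThree (⟨1, -1, 0, -89217, 10277941⟩ : WeierstrassCurve ℚ) :=
  x3LineDatumThree_of_cert_of_delta _ (by norm_num [Δ, b₂, b₄, b₆, b₈]) 184 230 5
    (by simp only [Ψ₃, eval_add, eval_mul, eval_pow, eval_C, eval_X, eval_ofNat]; norm_num [b₂, b₄, b₆, b₈])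
    (X2.CellACertN9.squarefree_of_nodup_primeFactorsList_natAbs (by norm_num) (by simp [Nat.primeFactorsList_ofNat])) (by norm_num)
    (by rw [KernelDisc.eval_Ψ₂Sq]; norm_num [b₂, b₄, b₆]) (by decide) (by decide) (by decide)

/-- `116550bj2` = `[1,-1,0,1760058,-1034190284]` (class `116550bj`, (G-ord, `e = 2`) at `3`; twist `12950l2`, `a₃(V) = 2`, non-anomalous; even line
`φ = χ_{5}`): `x₀ = 1084`, `D = 5`, `s = 41440`, `Ψ₂Sq(x₀) = 8586368000` ⇒ `X3LineDatumThree W`. [folklore] -/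
theorem x3LineDatumThree_116550bj2 : X3LineDatumThree (⟨1, -1, 0, 1760058, -1034190284⟩ : WeierstrassCurve ℚ) :=
  x3LineDatumThree_of_cert_of_delta _ (by norm_num [Δ, b₂, b₄, b₆, b₈]) 1084 41440 5
    (by simp only [Ψ₃, eval_add, eval_mul, eval_pow, eval_C, eval_X, eval_ofNat]; norm_num [b₂, b₄, b₆, b₈])
    (X2.CellACertN9.squarefree_of_nodup_primeFactorsList_natAbs (by norm_num) (by simp [Nat.primeFactorsList_ofNat])) (by norm_num)
    (by rw [KernelDisc.eval_Ψ₂Sq]; norm_num [b₂, b₄, b₆]) (by decide) (by decide) (by decide)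

/-- `116928cn2` = `[0,0,0,75156,78224816]` (class `116928cn`, (G-ord, `e = 2`) at `3`; twist `12992o2`, `a₃(V) = -1`, non-anomalous; even line
`φ = χ_{2}`): `x₀ = 6`, `D = 2`, `s = 12544`, `Ψ₂Sq(x₀) = 314703872` ⇒ `X3LineDatumThree W`. [folklore] -/
theorem x3LineDatumThree_116928cn2 : X3LineDatumThree (⟨0, 0, 0, 75156, 78224816⟩ : WeierstrassCurve ℚ) :=
  x3LineDatumThree_of_cert_of_delta _ (by norm_num [Δ, b₂, b₄, b₆, b₈]) 6 12544 2
    (by simp only [Ψ₃, eval_add, eval_mul, eval_pow, eval_C, eval_X, eval_ofNat]; norm_num [b₂, b₄, b₆, b₈])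
    Int.prime_two.squarefree (by norm_num)
    (by rw [KernelDisc.eval_Ψ₂Sq]; norm_num [b₂, b₄, b₆]) (by decide) (by decide) (by decide)

/-- `117117k2` = `[0,0,1,-1560,20790]` (class `117117k`, (G-ord, `e = 2`) at `3`; twist `13013b2`, `a₃(V) = -2` — ANOMALOUS (outside the end state as typed); even line
`φ = χ_{13}`): `x₀ = 39`, `D = 13`, `s = 77`, `Ψ₂Sq(x₀) = 77077` ⇒ `X3LineDatumThree W`. [folklore] -/
theorem x3LineDatumThree_117117k2 : X3LineDatumThree (⟨0, 0, 1, -1560, 20790⟩ : WeierstrassCurve ℚ) :=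
  x3LineDatumThree_of_cert_of_delta _ (by norm_num [Δ, b₂, b₄, b₆, b₈]) 39 77 13
    (by simp only [Ψ₃, eval_add, eval_mul, eval_pow, eval_C, eval_X, eval_ofNat]; norm_num [b₂, b₄, b₆, b₈])
    (X2.CellACertN9.squarefree_of_nodup_primeFactorsList_natAbs (by norm_num) (by simp [Nat.primeFactorsList_ofNat])) (by norm_num)
    (by rw [KernelDisc.eval_Ψ₂Sq]; norm_num [b₂, b₄, b₆]) (by decide) (by decide) (by decide)

/-- `117117n2` = `[0,0,1,-75036,-36579501]` (class `117117n`, (G-ord, `e = 2`) at `3`; twist `13013a2`, `a₃(V) = 1` — ANOMALOUS (outside the end state as typed); even line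
`φ = χ_{13}`): `x₀ = 624`, `D = 13`, `s = 7007`, `Ψ₂Sq(x₀) = 638274637` ⇒ `X3LineDatumThree W`. [folklore] -/
theorem x3LineDatumThree_117117n2 : X3LineDatumThree (⟨0, 0, 1, -75036, -36579501⟩ : WeierstrassCurve ℚ) :=
  x3LineDatumThree_of_cert_of_delta _ (by norm_num [Δ, b₂, b₄, b₆, b₈]) 624 7007 13
    (by simp only [Ψ₃, eval_add, eval_mul, eval_pow, eval_C, eval_X, eval_ofNat]; norm_num [b₂, b₄, b₆, b₈])
    (X2.CellACertN9.squarefree_of_nodup_primeFactorsList_natAbs (by norm_num) (by simp [Nat.primeFactorsList_ofNat])) (by norm_num)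
    (by rw [KernelDisc.eval_Ψ₂Sq]; norm_num [b₂, b₄, b₆]) (by decide) (by decide) (by decide)

/-- `117900y2` = `[0,0,0,-20325,2446625]` (class `117900y`, (G-ord, `e = 2`) at `3`; twist `13100c2`, `a₃(V) = 2`, non-anomalous; even line
`φ = χ_{5}`): `x₀ = 15`, `D = 5`, `s = 1310`, `Ψ₂Sq(x₀) = 8580500` ⇒ `X3LineDatumThree W`. [folklore] -/
theorem x3LineDatumThree_117900y2 : X3LineDatumThree (⟨0, 0, 0, -20325, 2446625⟩ : WeierstrassCurve ℚ) :=
  x3LineDatumThree_of_cert_of_delta _ (by norm_num [Δ, b₂, b₄, b₆, b₈]) 15 1310 5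
    (by simp only [Ψ₃, eval_add, eval_mul, eval_pow, eval_C, eval_X, eval_ofNat]; norm_num [b₂, b₄, b₆, b₈])
    (X2.CellACertN9.squarefree_of_nodup_primeFactorsList_natAbs (by norm_num) (by simp [Nat.primeFactorsList_ofNat])) (by norm_num)
    (by rw [KernelDisc.eval_Ψ₂Sq]; norm_num [b₂, b₄, b₆]) (by decide) (by decide) (by decide)

/-- `118080cp3` = `[0,0,0,-888492,317471024]` (class `118080cp`, (G-ord, `e = 2`) at `3`; twist `13120c3`, `a₃(V) = 2`, non-anomalous; even line
`φ = χ_{2}`): `x₀ = 726`, `D = 2`, `s = 10496`, `Ψ₂Sq(x₀) = 220332032` ⇒ `X3LineDatumThree W`. [folklore] -/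
theorem x3LineDatumThree_118080cp3 : X3LineDatumThree (⟨0, 0, 0, -888492, 317471024⟩ : WeierstrassCurve ℚ) :=
  x3LineDatumThree_of_cert_of_delta _ (by norm_num [Δ, b₂, b₄, b₆, b₈]) 726 10496 2
    (by simp only [Ψ₃, eval_add, eval_mul, eval_pow, eval_C, eval_X, eval_ofNat]; norm_num [b₂, b₄, b₆, b₈])
    Int.prime_two.squarefree (by norm_num)
    (by rw [KernelDisc.eval_Ψ₂Sq]; norm_num [b₂, b₄, b₆]) (by decide) (by decide) (by decide)

/-- `119700p3` = `[0,0,0,385800,1929125]` (class `119700p`, (G-ord, `e = 2`) at `3`; twist `13300g3`, `a₃(V) = 2`, non-anomalous; even line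
`φ = χ_{5}`): `x₀ = 240`, `D = 5`, `s = 9310`, `Ψ₂Sq(x₀) = 433380500` ⇒ `X3LineDatumThree W`. [folklore] -/
theorem x3LineDatumThree_119700p3 : X3LineDatumThree (⟨0, 0, 0, 385800, 1929125⟩ : WeierstrassCurve ℚ) :=
  x3LineDatumThree_of_cert_of_delta _ (by norm_num [Δ, b₂, b₄, b₆, b₈]) 240 9310 5
    (by simp only [Ψ₃, eval_add, eval_mul, eval_pow, eval_C, eval_X, eval_ofNat]; norm_num [b₂, b₄, b₆, b₈])
    (X2.CellACertN9.squarefree_of_nodup_primeFactorsList_natAbs (by norm_num) (by simp [Nat.primeFactorsList_ofNat])) (by norm_num)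
    (by rw [KernelDisc.eval_Ψ₂Sq]; norm_num [b₂, b₄, b₆]) (by decide) (by decide) (by decide)

/-- `119700t2` = `[0,0,0,-2820,41645]` (class `119700t`, (G-ord, `e = 2`) at `3`; twist `13300e2`, `a₃(V) = -1`, non-anomalous; even line
`φ = χ_{5}`): `x₀ = 60`, `D = 5`, `s = 266`, `Ψ₂Sq(x₀) = 353780` ⇒ `X3LineDatumThree W`. [folklore] -/
theorem x3LineDatumThree_119700t2 : X3LineDatumThree (⟨0, 0, 0, -2820, 41645⟩ : WeierstrassCurve ℚ) :=
  x3LineDatumThree_of_cert_of_delta _ (by norm_num [Δ, b₂, b₄, b₆, b₈]) 60 266 5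
    (by simp only [Ψ₃, eval_add, eval_mul, eval_pow, eval_C, eval_X, eval_ofNat]; norm_num [b₂, b₄, b₆, b₈])
    (X2.CellACertN9.squarefree_of_nodup_primeFactorsList_natAbs (by norm_num) (by simp [Nat.primeFactorsList_ofNat])) (by norm_num)
    (by rw [KernelDisc.eval_Ψ₂Sq]; norm_num [b₂, b₄, b₆]) (by decide) (by decide) (by decide)

/-- `119700u2` = `[0,0,0,-42825,-4746355]` (class `119700u`, (G-ord, `e = 2`) at `3`; twist `13300h2`, `a₃(V) = 2`, non-anomalous; even line
`φ = χ_{5}`): `x₀ = 375`, `D = 5`, `s = 5054`, `Ψ₂Sq(x₀) = 127714580` ⇒ `X3LineDatumThree W`. [folklore] -/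
theorem x3LineDatumThree_119700u2 : X3LineDatumThree (⟨0, 0, 0, -42825, -4746355⟩ : WeierstrassCurve ℚ) :=
  x3LineDatumThree_of_cert_of_delta _ (by norm_num [Δ, b₂, b₄, b₆, b₈]) 375 5054 5
    (by simp only [Ψ₃, eval_add, eval_mul, eval_pow, eval_C, eval_X, eval_ofNat]; norm_num [b₂, b₄, b₆, b₈])
    (X2.CellACertN9.squarefree_of_nodup_primeFactorsList_natAbs (by norm_num) (by simp [Nat.primeFactorsList_ofNat])) (by norm_num)
    (by rw [KernelDisc.eval_Ψ₂Sq]; norm_num [b₂, b₄, b₆]) (by decide) (by decide) (by decide)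

/-- `119700w2` = `[0,0,0,-40575,9449750]` (class `119700w`, (G-ord, `e = 2`) at `3`; twist `13300f2`, `a₃(V) = -1`, non-anomalous; even line
`φ = χ_{5}`): `x₀ = 15`, `D = 5`, `s = 2660`, `Ψ₂Sq(x₀) = 35378000` ⇒ `X3LineDatumThree W`. [folklore] -/
theorem x3LineDatumThree_119700w2 : X3LineDatumThree (⟨0, 0, 0, -40575, 9449750⟩ : WeierstrassCurve ℚ) :=
  x3LineDatumThree_of_cert_of_delta _ (by norm_num [Δ, b₂, b₄, b₆, b₈]) 15 2660 5
    (by simp only [Ψ₃, eval_add, eval_mul, eval_pow, eval_C, eval_X, eval_ofNat]; norm_num [b₂, b₄, b₆, b₈])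
    (X2.CellACertN9.squarefree_of_nodup_primeFactorsList_natAbs (by norm_num) (by simp [Nat.primeFactorsList_ofNat])) (by norm_num)
    (by rw [KernelDisc.eval_Ψ₂Sq]; norm_num [b₂, b₄, b₆]) (by decide) (by decide) (by decide)

/-- `119952en3` = `[0,0,0,-726915,238513282]` (class `119952en`, (G-ord, `e = 2`) at `3`; twist `13328w3`, `a₃(V) = -2` — ANOMALOUS (outside the end state as typed); even line
`φ = χ_{7}`): `x₀ = 525`, `D = 7`, `s = 952`, `Ψ₂Sq(x₀) = 6344128` ⇒ `X3LineDatumThree W`. [folklore] -/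
theorem x3LineDatumThree_119952en3 : X3LineDatumThree (⟨0, 0, 0, -726915, 238513282⟩ : WeierstrassCurve ℚ) :=
  x3LineDatumThree_of_cert_of_delta _ (by norm_num [Δ, b₂, b₄, b₆, b₈]) 525 952 7
    (by simp only [Ψ₃, eval_add, eval_mul, eval_pow, eval_C, eval_X, eval_ofNat]; norm_num [b₂, b₄, b₆, b₈])
    (X2.CellACertN9.squarefree_of_nodup_primeFactorsList_natAbs (by norm_num) (by simp [Nat.primeFactorsList_ofNat])) (by norm_num)
    (by rw [KernelDisc.eval_Ψ₂Sq]; norm_num [b₂, b₄, b₆]) (by decide) (by decide) (by decide)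

/-- `119952fj2` = `[0,0,0,4389,28042]` (class `119952fj`, (G-ord, `e = 2`) at `3`; twist `13328x2`, `a₃(V) = -2` — ANOMALOUS (outside the end state as typed); even line
`φ = χ_{7}`): `x₀ = 21`, `D = 7`, `s = 272`, `Ψ₂Sq(x₀) = 517888` ⇒ `X3LineDatumThree W`. [folklore] -/
theorem x3LineDatumThree_119952fj2 : X3LineDatumThree (⟨0, 0, 0, 4389, 28042⟩ : WeierstrassCurve ℚ) :=
  x3LineDatumThree_of_cert_of_delta _ (by norm_num [Δ, b₂, b₄, b₆, b₈]) 21 272 7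
    (by simp only [Ψ₃, eval_add, eval_mul, eval_pow, eval_C, eval_X, eval_ofNat]; norm_num [b₂, b₄, b₆, b₈])
    (X2.CellACertN9.squarefree_of_nodup_primeFactorsList_natAbs (by norm_num) (by simp [Nat.primeFactorsList_ofNat])) (by norm_num)
    (by rw [KernelDisc.eval_Ψ₂Sq]; norm_num [b₂, b₄, b₆]) (by decide) (by decide) (by decide)

/-- `121050z2` = `[1,-1,1,-10130,2301747]` (class `121050z`, (G-ord, `e = 2`) at `3`; twist `13450a2`, `a₃(V) = -1`, non-anomalous; even line
`φ = χ_{5}`): `x₀ = 4`, `D = 5`, `s = 1345`, `Ψ₂Sq(x₀) = 9045125` ⇒ `X3LineDatumThree W`. [folklore] -/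
theorem x3LineDatumThree_121050z2 : X3LineDatumThree (⟨1, -1, 1, -10130, 2301747⟩ : WeierstrassCurve ℚ) :=
  x3LineDatumThree_of_cert_of_delta _ (by norm_num [Δ, b₂, b₄, b₆, b₈]) 4 1345 5
    (by simp only [Ψ₃, eval_add, eval_mul, eval_pow, eval_C, eval_X, eval_ofNat]; norm_num [b₂, b₄, b₆, b₈])
    (X2.CellACertN9.squarefree_of_nodup_primeFactorsList_natAbs (by norm_num) (by simp [Nat.primeFactorsList_ofNat])) (by norm_num)
    (by rw [KernelDisc.eval_Ψ₂Sq]; norm_num [b₂, b₄, b₆]) (by decide) (by decide) (by decide)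

/-- `123210ba2` = `[1,-1,0,-228195,-470124675]` (class `123210ba`, (G-ord, `e = 2`) at `3`; twist `13690m2`, `a₃(V) = -2` — ANOMALOUS (outside the end state as typed); even line
`φ = χ_{37}`): `x₀ = 1360`, `D = 37`, `s = 13690`, `Ψ₂Sq(x₀) = 6934395700` ⇒ `X3LineDatumThree W`. [folklore] -/
theorem x3LineDatumThree_123210ba2 : X3LineDatumThree (⟨1, -1, 0, -228195, -470124675⟩ : WeierstrassCurve ℚ) :=
  x3LineDatumThree_of_cert_of_delta _ (by norm_num [Δ, b₂, b₄, b₆, b₈]) 1360 13690 37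
    (by simp only [Ψ₃, eval_add, eval_mul, eval_pow, eval_C, eval_X, eval_ofNat]; norm_num [b₂, b₄, b₆, b₈])
    (X2.CellACertN9.squarefree_of_nodup_primeFactorsList_natAbs (by norm_num) (by simp [Nat.primeFactorsList_ofNat])) (by norm_num)
    (by rw [KernelDisc.eval_Ψ₂Sq]; norm_num [b₂, b₄, b₆]) (by decide) (by decide) (by decide)

/-- `123210bd2` = `[1,-1,0,-1755,28701]` (class `123210bd`, (G-ord, `e = 2`) at `3`; twist `13690l2`, `a₃(V) = 1` — ANOMALOUS (outside the end state as typed); even line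
`φ = χ_{37}`): `x₀ = 28`, `D = 37`, `s = 10`, `Ψ₂Sq(x₀) = 3700` ⇒ `X3LineDatumThree W`. [folklore] -/
theorem x3LineDatumThree_123210bd2 : X3LineDatumThree (⟨1, -1, 0, -1755, 28701⟩ : WeierstrassCurve ℚ) :=
  x3LineDatumThree_of_cert_of_delta _ (by norm_num [Δ, b₂, b₄, b₆, b₈]) 28 10 37
    (by simp only [Ψ₃, eval_add, eval_mul, eval_pow, eval_C, eval_X, eval_ofNat]; norm_num [b₂, b₄, b₆, b₈])
    (X2.CellACertN9.squarefree_of_nodup_primeFactorsList_natAbs (by norm_num) (by simp [Nat.primeFactorsList_ofNat])) (by norm_num)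
    (by rw [KernelDisc.eval_Ψ₂Sq]; norm_num [b₂, b₄, b₆]) (by decide) (by decide) (by decide)

end Summit.BirchSwinnertonDyer.Rank1Residual.Additive.X3ThreeLineDatumRecords
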